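import Literature.AlgebraicGeometry.Frobenioids.Monoids
import Literature.AlgebraicGeometry.Frobenioids.Categories
import Mathlib.Algebra.Category.MonCat.Basic
import Mathlib.CategoryTheory.Opposites
import Mathlib.CategoryTheory.Discrete.Basic
import Mathlib.CategoryTheory.Functor.Const
import Mathlib.CategoryTheory.Endomorphism
import HarnessLib

/-!
# Frobenioids I, Definition 1.1: divisorial monoids, monoids on a category, elementary Frobenioids,
# pre-Frobenioids (STEP-0 calibration fragment of the abc-iut cell)

Mochizuki, *The geometry of Frobenioids I: the general theory*, Kyushu J. Math. **62** (2008)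
293–400, §1, Definition 1.1 (i)–(iv) and Remark 1.1.1, kurims text pp. 19–21
[cite: MochizukiFrdI2008, Def. 1.1].

* (i) pre-divisorial / group-like / divisorial monoids, non-dilating endomorphisms, and the remark
  "if `M` is pre-divisorial then `M^char` is divisorial" (proved);
* (ii) monoids `Φ` on a category `D` = contravariant functors `D → Mon` (here `Dᵒᵖ ⥤ CommMonCat`)
  whose pull-back maps are characteristically injective and invert FSM-morphisms; the
  characteristic `Φ^char`;
* (iii) the elementary Frobenioid `F_Φ` (objects of `D`; arrows `(φ_D, Z_φ, n_φ)` with the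
  printed composition law), its projection `F_Φ → D`, the operations `Base`, `Div`, `deg_Fr`, the
  monoid `F_M = M × N_{≥1}` with `(a₁,n₁)·(a₂,n₂) = (a₁ + n₁·a₂, n₁n₂)` and the identification of
  `F_M` with the endomorphism monoid of the one-object category `F_{Φ_M}` (proved), the standard
  Frobenioid `F = F_{ℤ_{≥0}}`;
* (iv) pre-Frobenioid structures `C → F_Φ` and Remark 1.1.1 (the behaviour of `Base`, `Div`,
  `deg_Fr` under composition; proved, by functoriality).

Conventions: monoids are written multiplicatively (see `Monoids.lean`), so the zero divisor of a
composite reads `Div(ψ ∘ φ) = φ^*(Div ψ) · Div(φ)^{deg_Fr ψ}`. Deliberately NOT here: the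
groupification `Φ^gp` and perfection `Φ^pf` of a monoid on `D` as functors (only named on p. 19;
first used in §2), Definitions 1.2–1.3. No statement of the paper is strengthened.
-/

namespace Literature.AlgebraicGeometry.Frobenioids

open CategoryTheory Opposite

universe w v v' u u'

/-! ### Definition 1.1 (i): pre-divisorial, group-like, divisorial, non-dilating -/

section DefOneOneI

variable (M : Type u) [CommMonoid M]

/-- `M` is *pre-divisorial* if it is integral, saturated and of characteristic type
(FrdI Def. 1.1 (i)). [cite: MochizukiFrdI2008, Def. 1.1(i)] -/
structure IsPreDivisorial : Prop where
  /-- `M → M^gp` is injective -/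
  isIntegral : IsIntegral M
  /-- `M` is saturated in `M^gp` -/
  isSaturated : IsSaturated M
  /-- units act freely -/
  isOfCharType : IsOfCharType M

/-- A pre-divisorial `M` is *group-like* if `M^char` is zero (FrdI Def. 1.1 (i)).
[cite: MochizukiFrdI2008, Def. 1.1(i)] -/
structure IsGroupLike : Prop where
  /-- pre-divisorial -/
  isPreDivisorial : IsPreDivisorial M
  /-- `M^char = 0`, i.e. every element is a unit -/
  subsingleton_associates : Subsingleton (Associates M)

/-- A pre-divisorial `M` is *divisorial* if it is sharp (FrdI Def. 1.1 (i)).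
[cite: MochizukiFrdI2008, Def. 1.1(i)] -/
structure IsDivisorial : Prop where
  /-- pre-divisorial -/
  isPreDivisorial : IsPreDivisorial M
  /-- no non-trivial units -/
  isSharp : IsSharp M

variable {M}

/-- `M^char` is always of characteristic type (its units are trivial). [cite: MochizukiFrdI2008, Def. 1.1(i)] -/
theorem isOfCharType_associates : IsOfCharType (Associates M) :=
  ⟨fun u _ _ => Units.ext (by rw [Associates.coe_unit_eq_one, Units.val_one])⟩

/-- "[Thus, if `M` is pre-divisorial, then `M^char` is divisorial.]" (FrdI Def. 1.1 (i)).
[cite: MochizukiFrdI2008, Def. 1.1(i)] -/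
theorem IsPreDivisorial.isDivisorial_associates (h : IsPreDivisorial M) :
    IsDivisorial (Associates M) where
  isPreDivisorial :=
    { isIntegral := h.isOfCharType.isIntegral_iff_associates.mp h.isIntegral
      isSaturated := isSaturated_iff_associates.mp h.isSaturated
      isOfCharType := isOfCharType_associates }
  isSharp := isSharp_associates

/-- An endomorphism `α` of a (pre-divisorial) monoid `M` is *non-dilating* if the induced
endomorphism `α^char` of `M^char` is the identity whenever `α^char(a) ≼ a` for all primary
`a ∈ M^char` (FrdI Def. 1.1 (i)). [cite: MochizukiFrdI2008, Def. 1.1(i)] -/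
def IsNonDilating (α : M →* M) : Prop :=
  (∀ a : Associates M, IsPrimary a → associatesMap α a ≼ a) → associatesMap α = MonoidHom.id _

end DefOneOneI

/-! ### Definition 1.1 (ii): monoids on a category -/

section DefOneOneII

variable {D : Type u} [Category.{v} D]

/-- The pull-back map `α^* : Φ(A) → Φ(B)` along `α : B → A` of a contravariant functor
`Φ : D → Mon` (FrdI Def. 1.1 (ii)). [cite: MochizukiFrdI2008, Def. 1.1(ii)] -/
def pull (Φ : Dᵒᵖ ⥤ CommMonCat.{w}) {A B : D} (α : B ⟶ A) : Φ.obj (op A) →* Φ.obj (op B) :=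
  (Φ.map α.op).hom

/-- `(id)^* = id`. [cite: MochizukiFrdI2008, Def. 1.1(ii)] -/
@[simp] theorem pull_id (Φ : Dᵒᵖ ⥤ CommMonCat.{w}) (A : D) (x : Φ.obj (op A)) :
    pull Φ (𝟙 A) x = x := by
  simp [pull]

/-- `(α ∘ β)^* = β^* ∘ α^*` (contravariance). [cite: MochizukiFrdI2008, Def. 1.1(ii)] -/
@[simp] theorem pull_comp (Φ : Dᵒᵖ ⥤ CommMonCat.{w}) {A B C : D} (β : C ⟶ B) (α : B ⟶ A)
    (x : Φ.obj (op A)) : pull Φ (β ≫ α) x = pull Φ β (pull Φ α x) := by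
  simp [pull]

/-- A contravariant functor `Φ : D → Mon` is a *monoid on `D`* if (a) every pull-back map `α^*` is
characteristically injective and (b) `α^*` is an isomorphism whenever `α` is an FSM-morphism
(FrdI Def. 1.1 (ii)). [cite: MochizukiFrdI2008, Def. 1.1(ii)] -/
structure IsMonoidOn (Φ : Dᵒᵖ ⥤ CommMonCat.{w}) : Prop where
  /-- (a) pull-backs are characteristically injective -/
  isCharInjective : ∀ {A B : D} (α : B ⟶ A), IsCharInjective (pull Φ α)
  /-- (b) FSM-morphisms pull back to isomorphisms -/
  bijective_of_isFSM : ∀ {A B : D} (α : B ⟶ A), IsFSM α → Function.Bijective (pull Φ α)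

/-- "If every monoid `Φ(A)` … satisfies some property of monoids …, then we shall say that `Φ`
satisfies this property" (FrdI Def. 1.1 (ii)): the objectwise extension of a property of monoids.
[cite: MochizukiFrdI2008, Def. 1.1(ii)] -/
def Objectwise (P : ∀ (M : Type w) [CommMonoid M], Prop) (Φ : Dᵒᵖ ⥤ CommMonCat.{w}) : Prop :=
  ∀ A : D, P (Φ.obj (op A))

/-- The *characteristic* `Φ^char : A ↦ Φ(A)^char` of a contravariant functor `Φ : D → Mon`
(FrdI Def. 1.1 (ii)). [cite: MochizukiFrdI2008, Def. 1.1(ii)] -/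
def charFunctor (Φ : Dᵒᵖ ⥤ CommMonCat.{w}) : Dᵒᵖ ⥤ CommMonCat.{w} where
  obj A := CommMonCat.of (Associates (Φ.obj A))
  map f := CommMonCat.ofHom (associatesMap (Φ.map f).hom)
  map_id A := by
    ext x
    obtain ⟨a, rfl⟩ := Associates.mk_surjective x
    simp [associatesMap_mk]
  map_comp f g := by
    ext x
    obtain ⟨a, rfl⟩ := Associates.mk_surjective x
    simp [associatesMap_mk]

/-- A pre-divisorial monoid `Φ` on `D` is *non-dilating* if the endomorphisms of the `Φ(A)` induced
by endomorphisms of `A` are non-dilating (FrdI Def. 1.1 (ii)). [cite: MochizukiFrdI2008, Def. 1.1(ii)] -/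
def IsNonDilatingOn (Φ : Dᵒᵖ ⥤ CommMonCat.{w}) : Prop :=
  ∀ (A : D) (α : A ⟶ A), IsNonDilating (pull Φ α)

end DefOneOneII

/-! ### Definition 1.1 (iii): the elementary Frobenioid `F_Φ` -/

section DefOneOneIII

variable {D : Type u} [Category.{v} D]

/-- The *elementary Frobenioid* `F_Φ` associated to `Φ`: its objects are the objects of `D`
(FrdI Def. 1.1 (iii)). [cite: MochizukiFrdI2008, Def. 1.1(iii)] -/
def ElemFrobenioid (_Φ : Dᵒᵖ ⥤ CommMonCat.{w}) : Type u := D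

namespace ElemFrobenioid

variable {Φ : Dᵒᵖ ⥤ CommMonCat.{w}}

/-- `Base(A)`, the projection of an object of `F_Φ` to `D` (FrdI Def. 1.1 (iii)).
[cite: MochizukiFrdI2008, Def. 1.1(iii)] -/
def base (A : ElemFrobenioid Φ) : D := A

variable (Φ) in
/-- An object of `D` regarded as an object of `F_Φ`. [cite: MochizukiFrdI2008, Def. 1.1(iii)] -/
def of (A : D) : ElemFrobenioid Φ := A

/-- `Base (of A) = A`. [cite: MochizukiFrdI2008, Def. 1.1(iii)] -/
@[simp] theorem base_of (A : D) : (of Φ A).base = A := rfl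

/-- A morphism `φ : A → B` of `F_Φ` is a triple `(φ_D, Z_φ, n_φ)`: the projection
`Base(φ) : A_D → B_D`, the zero divisor `Div(φ) ∈ Φ(A_D)` and the Frobenius degree
`deg_Fr(φ) ∈ N_{≥1}` (FrdI Def. 1.1 (iii)). [cite: MochizukiFrdI2008, Def. 1.1(iii)] -/
@[ext] structure Hom (A B : ElemFrobenioid Φ) : Type (max v w) where
  /-- `Base(φ)`, the projection to `D` -/
  base : A.base ⟶ B.base
  /-- `Div(φ)`, the zero divisor -/
  div : Φ.obj (op A.base)
  /-- `deg_Fr(φ)`, the Frobenius degree -/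
  degFr : ℕ+

/-- `F_Φ` is a category under `(ψ ∘ φ) = (ψ_D ∘ φ_D, φ_D^*(Z_ψ) + n_ψ · Z_φ, n_ψ · n_φ)`
(FrdI Def. 1.1 (iii); multiplicative rendering of `+`, `·`). [cite: MochizukiFrdI2008, Def. 1.1(iii)] -/
instance instCategory : Category.{max v w} (ElemFrobenioid Φ) where
  Hom := Hom
  id A := ⟨𝟙 A.base, 1, 1⟩
  comp φ ψ := ⟨φ.base ≫ ψ.base, pull Φ φ.base ψ.div * φ.div ^ (ψ.degFr : ℕ), φ.degFr * ψ.degFr⟩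
  id_comp φ := by
    ext
    · exact Category.id_comp _
    · show pull Φ (𝟙 _) φ.div * 1 ^ (φ.degFr : ℕ) = φ.div
      rw [pull_id, one_pow, mul_one]
    · exact one_mul _
  comp_id φ := by
    ext
    · exact Category.comp_id _
    · show pull Φ φ.base 1 * φ.div ^ ((1 : ℕ+) : ℕ) = φ.div
      rw [map_one, one_mul, PNat.one_coe, pow_one]
    · exact mul_one _
  assoc φ ψ χ := by
    ext
    · exact Category.assoc _ _ _
    · show pull Φ (φ.base ≫ ψ.base) χ.div * (pull Φ φ.base ψ.div * φ.div ^ (ψ.degFr : ℕ)) ^ (χ.degFr : ℕ)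
        = pull Φ φ.base (pull Φ ψ.base χ.div * ψ.div ^ (χ.degFr : ℕ)) * φ.div ^ ((ψ.degFr * χ.degFr : ℕ+) : ℕ)
      rw [pull_comp, map_mul, map_pow, mul_pow, ← pow_mul, PNat.mul_coe, mul_assoc]
    · exact mul_assoc _ _ _

/-- `Base(φ)`. [cite: MochizukiFrdI2008, Def. 1.1(iii)] -/
abbrev Base {A B : ElemFrobenioid Φ} (φ : A ⟶ B) : A.base ⟶ B.base := Hom.base φ

/-- `Div(φ)`, the zero divisor. [cite: MochizukiFrdI2008, Def. 1.1(iii)] -/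
abbrev Div {A B : ElemFrobenioid Φ} (φ : A ⟶ B) : Φ.obj (op A.base) := Hom.div φ

/-- `deg_Fr(φ)`, the Frobenius degree. [cite: MochizukiFrdI2008, Def. 1.1(iii)] -/
abbrev degFr {A B : ElemFrobenioid Φ} (φ : A ⟶ B) : ℕ+ := Hom.degFr φ

/-- `Base(id) = id`. [cite: MochizukiFrdI2008, Def. 1.1(iii)] -/
@[simp] theorem base_id (A : ElemFrobenioid Φ) : Base (𝟙 A) = 𝟙 A.base := rfl

/-- `Div(id) = 0`. [cite: MochizukiFrdI2008, Def. 1.1(iii)] -/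
@[simp] theorem div_id (A : ElemFrobenioid Φ) : Div (𝟙 A) = 1 := rfl

/-- `deg_Fr(id) = 1`. [cite: MochizukiFrdI2008, Def. 1.1(iii)] -/
@[simp] theorem degFr_id (A : ElemFrobenioid Φ) : degFr (𝟙 A) = 1 := rfl

/-- `Base(ψ ∘ φ) = Base(ψ) ∘ Base(φ)`. [cite: MochizukiFrdI2008, Def. 1.1(iii)] -/
@[simp] theorem base_comp {A B C : ElemFrobenioid Φ} (φ : A ⟶ B) (ψ : B ⟶ C) :
    Base (φ ≫ ψ) = Base φ ≫ Base ψ := rfl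

/-- `Div(ψ ∘ φ) = φ_D^*(Div ψ) + deg_Fr(ψ) · Div(φ)`. [cite: MochizukiFrdI2008, Def. 1.1(iii)] -/
@[simp] theorem div_comp {A B C : ElemFrobenioid Φ} (φ : A ⟶ B) (ψ : B ⟶ C) :
    Div (φ ≫ ψ) = pull Φ (Base φ) (Div ψ) * Div φ ^ (degFr ψ : ℕ) := rfl

/-- `deg_Fr(ψ ∘ φ) = deg_Fr(ψ) · deg_Fr(φ)`. [cite: MochizukiFrdI2008, Def. 1.1(iii)] -/
@[simp] theorem degFr_comp {A B C : ElemFrobenioid Φ} (φ : A ⟶ B) (ψ : B ⟶ C) :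
    degFr (φ ≫ ψ) = degFr φ * degFr ψ := rfl

/-- Constructor for morphisms of `F_Φ` from the triple `(φ_D, Z_φ, n_φ)`.
[cite: MochizukiFrdI2008, Def. 1.1(iii)] -/
def homMk {A B : ElemFrobenioid Φ} (f : A.base ⟶ B.base) (Z : Φ.obj (op A.base)) (n : ℕ+) :
    A ⟶ B := ⟨f, Z, n⟩

/-- Components of `homMk`. [cite: MochizukiFrdI2008, Def. 1.1(iii)] -/
@[simp] theorem base_homMk {A B : ElemFrobenioid Φ} (f : A.base ⟶ B.base) (Z : Φ.obj (op A.base))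
    (n : ℕ+) : Base (homMk f Z n) = f := rfl

/-- Components of `homMk`. [cite: MochizukiFrdI2008, Def. 1.1(iii)] -/
@[simp] theorem div_homMk {A B : ElemFrobenioid Φ} (f : A.base ⟶ B.base) (Z : Φ.obj (op A.base))
    (n : ℕ+) : Div (homMk f Z n) = Z := rfl

/-- Components of `homMk`. [cite: MochizukiFrdI2008, Def. 1.1(iii)] -/
@[simp] theorem degFr_homMk {A B : ElemFrobenioid Φ} (f : A.base ⟶ B.base)
    (Z : Φ.obj (op A.base)) (n : ℕ+) : degFr (homMk f Z n) = n := rfl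

variable (Φ) in
/-- The natural projection functor `F_Φ → D` to the *base category* (FrdI Def. 1.1 (iii)).
[cite: MochizukiFrdI2008, Def. 1.1(iii)] -/
def baseFunctor : ElemFrobenioid Φ ⥤ D where
  obj A := A.base
  map φ := Base φ

/-- The projection functor on objects. [cite: MochizukiFrdI2008, Def. 1.1(iii)] -/
@[simp] theorem baseFunctor_obj (A : ElemFrobenioid Φ) : (baseFunctor Φ).obj A = A.base := rfl

/-- The projection functor on arrows. [cite: MochizukiFrdI2008, Def. 1.1(iii)] -/
@[simp] theorem baseFunctor_map {A B : ElemFrobenioid Φ} (φ : A ⟶ B) :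
    (baseFunctor Φ).map φ = Base φ := rfl

end ElemFrobenioid

/-! ### The monoid `F_M` and the standard Frobenioid -/

/-- `F_M`: the elementary Frobenioid of a monoid `M` regarded as the endomorphism monoid of a
one-object category; underlying set `M × N_{≥1}` with `(a₁, n₁) · (a₂, n₂) = (a₁ + n₁ · a₂, n₁ n₂)`
(FrdI Def. 1.1 (iii); multiplicatively `(a₁ · a₂^{n₁}, n₁ n₂)`). [cite: MochizukiFrdI2008, Def. 1.1(iii)] -/
@[ext] structure ElemFrobenioidMonoid (M : Type u) [CommMonoid M] : Type u where
  /-- the `M`-component (zero divisor) -/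
  div : M
  /-- the Frobenius degree -/
  degFr : ℕ+

namespace ElemFrobenioidMonoid

variable {M : Type u} [CommMonoid M]

/-- The monoid structure `(a₁, n₁) · (a₂, n₂) = (a₁ · a₂^{n₁}, n₁ n₂)` on `F_M`
(FrdI Def. 1.1 (iii)). [cite: MochizukiFrdI2008, Def. 1.1(iii)] -/
instance instMonoid : Monoid (ElemFrobenioidMonoid M) where
  mul x y := ⟨x.div * y.div ^ (x.degFr : ℕ), x.degFr * y.degFr⟩
  one := ⟨1, 1⟩
  mul_assoc x y z := by
    ext
    · show x.div * y.div ^ (x.degFr : ℕ) * z.div ^ ((x.degFr * y.degFr : ℕ+) : ℕ)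
        = x.div * (y.div * z.div ^ (y.degFr : ℕ)) ^ (x.degFr : ℕ)
      rw [mul_pow, ← pow_mul, PNat.mul_coe, mul_comm (y.degFr : ℕ), mul_assoc]
    · exact mul_assoc _ _ _
  one_mul x := by
    ext
    · show 1 * x.div ^ ((1 : ℕ+) : ℕ) = x.div
      rw [PNat.one_coe, pow_one, one_mul]
    · exact one_mul _
  mul_one x := by
    ext
    · show x.div * 1 ^ (x.degFr : ℕ) = x.div
      rw [one_pow, mul_one]
    · exact mul_one _

/-- Multiplication in `F_M`, first component. [cite: MochizukiFrdI2008, Def. 1.1(iii)] -/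
@[simp] theorem mul_div (x y : ElemFrobenioidMonoid M) : (x * y).div = x.div * y.div ^ (x.degFr : ℕ) :=
  rfl

/-- Multiplication in `F_M`, second component. [cite: MochizukiFrdI2008, Def. 1.1(iii)] -/
@[simp] theorem mul_degFr (x y : ElemFrobenioidMonoid M) : (x * y).degFr = x.degFr * y.degFr := rfl

/-- The unit of `F_M`. [cite: MochizukiFrdI2008, Def. 1.1(iii)] -/
@[simp] theorem one_div : (1 : ElemFrobenioidMonoid M).div = 1 := rfl

/-- The unit of `F_M`. [cite: MochizukiFrdI2008, Def. 1.1(iii)] -/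
@[simp] theorem one_degFr : (1 : ElemFrobenioidMonoid M).degFr = 1 := rfl

end ElemFrobenioidMonoid

section OneObject

variable (M : Type w) [CommMonoid M]

/-- The functor `Φ_M` on the one-morphism category assigning `M` to its unique object
(FrdI Def. 1.1 (iii)). [cite: MochizukiFrdI2008, Def. 1.1(iii)] -/
def constMonoidOn : (Discrete PUnit.{w + 1})ᵒᵖ ⥤ CommMonCat.{w} :=
  (Functor.const _).obj (CommMonCat.of M)

/-- "the elementary Frobenioid `F_{Φ_M}` … is itself a one-object category, whose endomorphism
monoid we shall denote by `F_M`": the endomorphism monoid of the unique object of `F_{Φ_M}` is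
`F_M` (FrdI Def. 1.1 (iii); recall `End`'s product is `f * g = g ≫ f = f ∘ g`).
[cite: MochizukiFrdI2008, Def. 1.1(iii)] -/
def elemFrobenioidMonoidEquivEnd :
    ElemFrobenioidMonoid M ≃* End (ElemFrobenioid.of (constMonoidOn M) (Discrete.mk PUnit.unit)) where
  toFun x := ElemFrobenioid.homMk (𝟙 _) x.div x.degFr
  invFun φ := ⟨ElemFrobenioid.Div φ, ElemFrobenioid.degFr φ⟩
  left_inv x := rfl
  right_inv φ := by
    refine ElemFrobenioid.Hom.ext (Subsingleton.elim _ _) rfl rfl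
  map_mul' x y := by
    refine ElemFrobenioid.Hom.ext (Subsingleton.elim _ _) ?_ ?_
    · change _ = pull (constMonoidOn M) (𝟙 (Discrete.mk PUnit.unit)) x.div * _
      rw [pull_id]
      rfl
    · show x.degFr * y.degFr = y.degFr * x.degFr
      exact mul_comm _ _

/-- The *standard Frobenioid* `F := F_{ℤ_{≥0}}` (FrdI Def. 1.1 (iii); `ℤ_{≥0}` rendered as
`Multiplicative ℕ`). [cite: MochizukiFrdI2008, Def. 1.1(iii)] -/
abbrev StandardFrobenioid : Type := ElemFrobenioidMonoid (Multiplicative ℕ)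

end OneObject

end DefOneOneIII

/-! ### Definition 1.1 (iv): pre-Frobenioids; Remark 1.1.1 -/

section DefOneOneIV

variable {D : Type u} [Category.{v} D] {Φ : Dᵒᵖ ⥤ CommMonCat.{w}}
  {C : Type u'} [Category.{v'} C]

variable (Φ) in
/-- A functor `C → F_Φ` is a *pre-Frobenioid structure* on `C` when `Φ` is a divisorial monoid on
`D` and `C`, `D` are connected, totally epimorphic categories; `C` so equipped is a
*pre-Frobenioid* with *divisor monoid* `Φ` and *base category* `D` (FrdI Def. 1.1 (iv)).
[cite: MochizukiFrdI2008, Def. 1.1(iv)] -/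
structure IsPreFrobenioid (F : C ⥤ ElemFrobenioid Φ) : Prop where
  /-- `Φ` is a monoid on `D` … -/
  isMonoidOn : IsMonoidOn Φ
  /-- … which is divisorial -/
  isDivisorial : Objectwise (fun M _ => IsDivisorial M) Φ
  /-- the base category is connected -/
  isGraphConnected_base : IsGraphConnected D
  /-- the base category is totally epimorphic -/
  isTotallyEpimorphic_base : IsTotallyEpimorphic D
  /-- `C` is connected -/
  isGraphConnected : IsGraphConnected C
  /-- `C` is totally epimorphic -/
  isTotallyEpimorphic : IsTotallyEpimorphic C

namespace PreFrobenioid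

variable (F : C ⥤ ElemFrobenioid Φ)

/-- The natural projection functor `C → D` of a pre-Frobenioid (FrdI Def. 1.1 (iv)).
[cite: MochizukiFrdI2008, Def. 1.1(iv)] -/
def baseFunctor : C ⥤ D := F ⋙ ElemFrobenioid.baseFunctor Φ

/-- `Base(A)` for an object of a pre-Frobenioid. [cite: MochizukiFrdI2008, Def. 1.1(iv)] -/
abbrev baseObj (A : C) : D := (F.obj A).base

/-- `Base(φ)` for an arrow of a pre-Frobenioid ("by abuse of notation", FrdI Def. 1.1 (iv)).
[cite: MochizukiFrdI2008, Def. 1.1(iv)] -/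
abbrev Base {A B : C} (φ : A ⟶ B) : baseObj F A ⟶ baseObj F B := ElemFrobenioid.Base (F.map φ)

/-- `Div(φ) ∈ Φ(Base A)` for an arrow of a pre-Frobenioid. [cite: MochizukiFrdI2008, Def. 1.1(iv)] -/
abbrev Div {A B : C} (φ : A ⟶ B) : Φ.obj (op (baseObj F A)) := ElemFrobenioid.Div (F.map φ)

/-- `deg_Fr(φ)` for an arrow of a pre-Frobenioid. [cite: MochizukiFrdI2008, Def. 1.1(iv)] -/
abbrev degFr {A B : C} (φ : A ⟶ B) : ℕ+ := ElemFrobenioid.degFr (F.map φ)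

/-- Remark 1.1.1: `Base(φ ∘ ψ) = Base(φ) ∘ Base(ψ)`. [cite: MochizukiFrdI2008, Rem. 1.1.1] -/
theorem base_comp {A B C' : C} (ψ : A ⟶ B) (φ : B ⟶ C') :
    Base F (ψ ≫ φ) = Base F ψ ≫ Base F φ := by
  simp only [Base, Functor.map_comp, ElemFrobenioid.base_comp]

/-- Remark 1.1.1: `Div(φ ∘ ψ) = (Base ψ)^*(Div φ) + deg_Fr(φ) · Div(ψ)`. [cite: MochizukiFrdI2008, Rem. 1.1.1] -/
theorem div_comp {A B C' : C} (ψ : A ⟶ B) (φ : B ⟶ C') :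
    Div F (ψ ≫ φ) = pull Φ (Base F ψ) (Div F φ) * Div F ψ ^ (degFr F φ : ℕ) := by
  simp only [Div, Functor.map_comp, ElemFrobenioid.div_comp]

/-- Remark 1.1.1: `deg_Fr(φ ∘ ψ) = deg_Fr(φ) · deg_Fr(ψ)`. [cite: MochizukiFrdI2008, Rem. 1.1.1] -/
theorem degFr_comp {A B C' : C} (ψ : A ⟶ B) (φ : B ⟶ C') :
    degFr F (ψ ≫ φ) = degFr F ψ * degFr F φ := by
  simp only [degFr, Functor.map_comp, ElemFrobenioid.degFr_comp]

/-- `Base(id) = id`. [cite: MochizukiFrdI2008, Rem. 1.1.1] -/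
theorem base_id (A : C) : Base F (𝟙 A) = 𝟙 (baseObj F A) :=
  (congrArg (ElemFrobenioid.Base (A := F.obj A) (B := F.obj A)) (F.map_id A)).trans rfl

/-- `Div(id) = 0`. [cite: MochizukiFrdI2008, Rem. 1.1.1] -/
theorem div_id (A : C) : Div F (𝟙 A) = 1 :=
  (congrArg (ElemFrobenioid.Div (A := F.obj A) (B := F.obj A)) (F.map_id A)).trans rfl

/-- `deg_Fr(id) = 1`. [cite: MochizukiFrdI2008, Rem. 1.1.1] -/
theorem degFr_id (A : C) : degFr F (𝟙 A) = 1 :=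
  (congrArg (ElemFrobenioid.degFr (A := F.obj A) (B := F.obj A)) (F.map_id A)).trans rfl

end PreFrobenioid

end DefOneOneIV

end Literature.AlgebraicGeometry.Frobenioids
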